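import Literature.MathematicalPhysics.QuantumFieldTheory.Balaban1983to89.B6Line3CubeV1L0
import Literature.MathematicalPhysics.QuantumFieldTheory.Balaban1983to89.B6MemberOfCubeV1L0
import Literature.MathematicalPhysics.QuantumFieldTheory.Balaban1983to89.B6ScalarChartV1L0
import Literature.MathematicalPhysics.QuantumFieldTheory.Balaban1983to89.B6Prop26KLevelSkeletonV1L0
import Literature.MathematicalPhysics.QuantumFieldTheory.Balaban1983to89.B6CubeCoeffSizesV1L0
import HarnessLib
import Literature.MathematicalPhysics.QuantumFieldTheory.Balaban1983to89.B6Cover236MultiLevelBlocksL0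
import Literature.MathematicalPhysics.QuantumFieldTheory.Balaban1983to89.B6Geom246MultiLevelBoxL0
import Literature.MathematicalPhysics.QuantumFieldTheory.Balaban1983to89.B6Geom246MultiLevelTorusL0
import Literature.MathematicalPhysics.QuantumFieldTheory.Balaban1983to89.B6GlobalChartV1L0
import Literature.MathematicalPhysics.QuantumFieldTheory.Balaban1983to89.B6MultiLevelBoxOperatorL0
import Literature.MathematicalPhysics.QuantumFieldTheory.Balaban1983to89.B6MultiLevelTorusOperatorL0
import Literature.MathematicalPhysics.QuantumFieldTheory.Balaban1983to89.B6Ineq2142KLevelV1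

/-!
# `Balaban1983to89.B6Ineq2142KLevelV1L0` — LEVEL-0 TWIN (programme G-F3′-L0, director-ym LINE №27 / UV3-NODE §24.5; plan `lit-balaban-r03/G-F3L0-PLAN.md`) of `B6Ineq2142KLevelV1`:
the same declarations, SAME NAMES AND STATEMENTS, for nested families WITH print's region `Λ₀ = T ∖ Ω₁` ADMITTED (structures
`B6MultiLevelBoxOperatorL0.Domains` / `B6MultiLevelTorusOperatorL0.TDomains`: levels `0, …, k`, the level-`0` block a single site, `Q′₀ = id`,
finite weight `a₀` — print p.225 (2.14) «Σ_{j=0}^k … (Q′₀λ)(x) = λ(x), x ∈ Λ₀», p.229 «taking a sequence (2.1) … smallest possible domains B^j(Λ_j),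
and considering the operator Δ_a defined by (2.19), (2.20) for this sequence»).  Every `D`-free object is the lineage's, consumed BY NAME; no existing
module is touched; no fact is minted.  Unit `lit-balaban-r03` (B6 fold owner; port r03 gen 36, filed by the successor seat r03 gen 37 —
declarations unchanged from the g36 staged text); referee ref-4.  THE TWIN'S DOCUMENTATION FOLLOWS
VERBATIM (its «levels 1 … k» / «Ω₁ = X» sentences describe the twin; here `j` runs from `0` and `Ω₁` may be a proper subset).

# `Balaban1983to89.B6Ineq2142KLevelV1` — T. Bałaban, *Propagators and renormalization transformations for lattice gauge theories. II*,
# Commun. Math. Phys. **96** (1984) 223–250 [Balaban1984PropagatorsII], p. 248 **(2.142) «From (2.136) we have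
# |(QGQ*)(b, b′)| ≤ O(1)(L^jη)²(L^{j′}η)^{−d}e^{−δ₃d(b,b′)}, b ∈ Λ_j, b′ ∈ Λ_{j′}» FOR THE GENUINE k-LEVEL OPERATOR `QGQ*`** of the V1 torus
# (`Q = B6SectAOperatorsV1.QE`, `G = Δ_a⁻¹ = B6SectAVectorModelV1.GE` over the nested family `B6GlobalChartV1L0.domT` of p21's torus families
# `TDomains`), from r03 gen 22's k-level (2.136)₁ `B6Line3CubeV1L0.prop26_2136_kLevel_unconditional` — file (W2) of ROUTE W (B6-CLOSURE.md §5 item 17: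
# Proposition 2.7 (2.149) at k levels by «the theory developed in Sect. 5 [3]»; this file is its entry-decay input and the shared index-bond
# infrastructure); no existing module is touched; no fact is minted

statement-level skeleton of published theorems with citation tags; proofs where landed; nothing here is a claim about the Yang–Mills mass gap

PDF held: `paper:balaban1984-cmp96-propagators-rt-ii` (journal page = PDF page + 222); p. 248 [PDF 26] re-read this generation (materialised text
`p0026.txt`), p. 247 [PDF 25] (Prop. 2.6), p. 231 [PDF 9] ((2.45)–(2.46)), p. 224 [PDF 2] ((2.1)–(2.4)); [Balaban1984PropagatorsI] (1.11)/(1.18) pp. 19–20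
(the straight-contour average `Q`, `Q_k`).  Unit `lit-balaban-r03` (B6 fold owner; r03 gen 23, literature-prover-lit-balaban-r03-g23-0), HOME
`run/shared/lean/pub/lit-balaban/`; referee ref-4.  SKELETON rows **B6.Eq2.142** (decls of record: r03 g5's abstract `B6Ineq2142.ineq2142_of_2136`,
the one-scale `B6Prop27OneScaleTorus`, p22's two-scale `B6Eq2143TwoScaleV1`; THIS FILE = the first genuinely multi-level member) × B6.Prop2.6 (consumer
of `prop26_2136_kLevel_unconditional`) × B6.Eq2.1 (index bonds of `domT`).

## WHAT IS PRINTED (verbatim up to notation)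

p. 248: *"Finally let us consider the operator QGQ* and its inverse. We consider these operators on the L²-space defined by (2.69) with sites
replaced by bonds. The operator QGQ* is positive, hence the inverse is well defined and positive also. We want to prove similar bounds as for
the operator Q′G′²Q′* and we will follow rather closely the arguments given for it. From (2.136) we have
|(QGQ*)(b, b′)| ≤ O(1)(L^jη)²(L^{j′}η)^{−d}e^{−δ₃d(b,b′)}, b ∈ Λ_j, b′ ∈ Λ_{j′}. (2.142)"*  [Balaban1984PropagatorsI] p. 20: *"(Q_kA)_b =
Σ_{x∈B^k(b₋)} η^{d+1} A([x, x(b)]) (1.18)"*.  p. 231: *"d(x, x′) = d(y, y′) if x ∈ B^j(y), x′ ∈ B^{j′}(y′)."*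

## WHAT THIS FILE CERTIFIES (kernel-checked, sorry-free, standard axioms; lattice units, dimension `D = d + 1`, `L = ℓ + 1`)

For every V1 global torus (`hN`), every torus family `D : TDomains d ℓ Mh k P′ R` (`k ≥ 1`, `R·M_h ≥ 2` where levels matter), the V1 domain
datum `domT hN D hk` and its index bonds `i : BondIdx (domT hN D hk)` (`i = ⟨j, b⟩`, `b = ⟨y, y + e_μ⟩ ∈ T^{(j)}`, `LamBond j b`):
* §1 `one_le_lvl` (no index bond has level `0`: `Ω₁ = T_η`), the BASE END-POINT `base i ∈ Ω_j^{(j)}` (the source if it lies in `Ω_j^{(j)}`, else the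
  target; `base_mem`, `not_deep_base`, `ends_eq`), `lev_eq_of_base` (EVERY fine site of `B^j(base i)` has p21-level exactly `j`), the CARRIER BLOCK
  **`β i ∈ 𝔅`** (`beta_level`, `blkOf_eq_beta`: `B^j(base i)` IS the `𝔅`-block `β i`), `lev_le_of_ends`; §1b `torusSupNorm_lt_of_block_eq`, `near_base`
  (the double block `B^j(y) ∪ B^j(y + e_μ)` lies within torus distance `2L^j` of the base site), **`pred_le_lev_of_ends`** (its fine sites have level
  `≥ j − 1`: (2.2) `B6MultiLevelTorusOperatorL0.TDomains.sepT (j − 1)`), `lev_ends_bounds`;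
* §2 THE AVERAGING WEIGHTS ([Balaban1984PropagatorsI] (1.18) `bondAvgIter_eq_blockSum`): `QE_apply_eq_sum` (`(Qv)_i = L^{−j(D+1)}Σ_{x ∈ B^j(y)}Σ_{t<L^j}
  v([x+te_μ, x+(t+1)e_μ])`), `abs_QE_apply_le` (an average), the weight function **`qwt i`** with `QsE_single_apply` (`Q*e_i = q_i`), `qwt_eq_sum`,
  `qwt_nonneg`, **`qwt_le`** (`q_i ≤ L^{−jD}`: each fine bond is hit by at most `L^j` of the `L^{j(D+1)}` pairs `(x, t)`), `exists_of_qwt_ne_zero` (support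
  ⊂ the straight contours of `i`); the FLAT MATRIX **`X hN D hk hcf hw i i′ = ⟪e_i, QGQ*e_{i′}⟫`** (`X_eq_inner`, **`X_symm`**, `X_eq_sum`);
* §3 THE GEOMETRY OF THE DOUBLE BLOCK in p21's torus graph distance (2.46): `blkOf_eq_of_sameBlock` (sites of level `≥ n` in one `n`-block share their
  `𝔅`-block), `blkOf_shift_eq` (blocks change along `e_μ` only at multiples of `L^n`), `distT_shift_le_one`, the run lemma `distT_run_le` with
  `crossings_le` (`≤ T/L^n + 2` crossings), `iterBlockOf_runSite_mem` (a run of `≤ L^j` steps from `B^j(y)` stays in the double block), `exists_run_start`,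
  and **`distT_ends_le`**: every `𝔅`-block met by the double block is within graph distance `L + 2` of `β i` (`n = max(j − 1, 1)`);
* §4 `abs_apply_le_of_support` (a majorant bounds `T` on functions supported over finitely many blocks), `metBlocks i` with **`card_metBlocks_le`**
  (`≤ 2L^D` blocks met, by counting fibres of `z ↦ y(z)` over `max(j−1,1)`-blocks), `abs_apply_qwt_le`, **`ineq2142_of_majorant`** ((2.136)₁-majorant
  `A·pref·e^{−δd_T}` ⇒ `|X(i,i′)| ≤ 2L^D·A·e^{2δ(L+2)}·(L^{j(i)}/c_f)²·(L^{j(i′)D})⁻¹·e^{−δ d_T(β i, β i′)}`), and **`ineq2142_kLevel`** = (2.142) FOR THE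
  GENUINE k-LEVEL `QGQ*`: `∃ σ₁ > 0 ∀ σ ∈ (0, σ₁] ∀ α ∈ (0, 1] ∃ A′ ≥ 0, M₂ > 0` such that for every V1 torus of ROUTE V (`k ≥ 2`, `M_h = L^a ≥ 8`,
  `M₂ ≤ L·M_h`, `R ≥ 2L²`, `P′ ≥ 5`, `L ≥ 5`, `Placed`), `c_f ≠ 0`, weights in the band (2.16), ALL index bonds `i, i′`:
  `|⟪e_i, QGQ*e_{i′}⟫| ≤ A′·(L^{j(i)}/c_f)²·(L^{j(i′)D})⁻¹·e^{−delta3 α (2σ)·d_T(β i, β i′)}` — print's `O(1)(L^jη)²(L^{j′}η)^{−d}e^{−δ₃d(b,b′)}` in the flat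
  basis of lattice units (`A′ = 2L^D·A·e^{2δ₃(L+2)}`, `A`, `δ₃` the constant and rate of (2.136)₁ `prop26_2136_kLevel_unconditional`); `abs_X_le_symm`.

## HONEST SCOPE

(1) Exactly the setting hypotheses of `prop26_2136_kLevel_unconditional` (V1 torus, `M_h = L^a`, `Placed` — dischargeable at `L = 5`, `P′ ≥ 12` by
`…_L5`, or for every odd `L ≥ 5` through p38's padded twin; not done here).  (2) `d(b, b′)` of print is read as p21's torus graph distance (2.46)
between the carrier blocks `β i`, `β i′` (the blocks `B^j(base)`; print: `b ∈ Λ_j`); the other end block is within `L + 2` of it (§3), immaterial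
up to the constant.  (3) The pairing: print's kernel w.r.t. the (2.69)-type pairing with weights `(L^{j′}η)^d` ↔ our flat matrix entry with the
explicit factor `(L^{j′})^{−D}`; `η`-powers are the lattice factor `c_f`.  (4) Constants ours (not optimised); value = the (2.142) input of ROUTE W
(Prop. 2.7 at k levels) + reusable index-bond infrastructure; NOT summit progress.
-/

noncomputable section

open scoped BigOperators InnerProductSpace
open Finset

namespace Literature.MathematicalPhysics.QuantumFieldTheory.Balaban1983to89.B6Ineq2142KLevelV1L0

open LatticeFieldCalculus
open B4Reflection242 (boxDom mem_boxDom blk)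
open B4ContourShift (supNorm)
open B4TorusKernel.MultiPeriod (torusSupNorm circAbs circAbs_le_abs circAbs_add_mul)
open B5Eq118OneStroke (iterBlockOf iterBlock mem_iterBlock val_iterBlockOf iterBlockOf_zero iterBlockOf_succ bondAvgIter_eq_blockSum
  runSite_mem_iterBlock_tgt iterBlockOf_runSite)
open B6MultiLevelBoxOperator (N0 bigSide one_le_bigSide)
open B6MultiLevelBoxOperatorL0 (Domains)
open B6MultiLevelTorusOperator (N0_eq_bigSide_mul tshift unitVec)
open B6MultiLevelTorusOperatorL0 (TDomains)
open B6CubeCoeffSizesV1 (torusSupNorm_tshift_unitVec_le)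
open B6Geom246MultiLevelBoxL0 (bset blkOf blkOf_val exists_blkOf_eq lev_eq_of_blkOf_eq blkOf_eq_iff_blk)
open B6Geom246MultiLevelTorus (torusSupNorm_neg)
open B6Geom246MultiLevelTorusL0 (geomT bondT TouchT bondT_adj)
open B6GlobalChartV1 (PV toBox toBox_apply blk_toBox)
open B6GlobalChartV1L0 (domT blkV1 iterBlockOf_mem_domT_iff)
open B6ScalarChartV1 (toBox_shift iterBlockOf_eq_iff_blk)
open B6ScalarChartV1L0 (blkOf_toBox_eq_iff)
open B6MemberOfCubeV1 (torusSupNorm_lt_of_block_shift torusSupNorm_sub_le one_le_N0)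
open B6AgreeQaQV1Chart (sitesPerDir_zero_eq_mul iterBlock_nonempty)
open B6RandomWalk (HasMajorant hasMajorant_mono BlockSupp blockPiece sum_blockPiece blockSupp_blockPiece delta3)
open B6Ineq2133TwoScaleV1 (onFun onFun_apply)
open B6SectAOperatorsV1 (QE QsE aE BondIdx BondIdxSpace inner_QsE_left inner_eq_sum)
open B6SectAVectorModelV1 (GE inner_GE_left)
open B6Prop26KLevelSkeletonV1L0 (pref)
open B6Cover236MultiLevelBlocksL0 (cubes)
open B6CubeWindowV1 (Placed GlobalBand)
open B6Line3CubeV1L0 (prop26_2136_kLevel_unconditional)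
open BalabanImbrieJaffe1984to88.BIJ85AxialPropagator411 (BondSpace)
open Literature.MathematicalPhysics.QuantumFieldTheory.Balaban1983to89.B6Ineq2142KLevelV1 (torusSupNorm_lt_of_block_eq cQ cQ_pos cQ_eq cQ_mul_card runSite_injOn pow_le_sitesPerDir iterBlockOf_eq_of_le val_shift_self shift_apply_of_ne iterBlockOf_shift_eq crossings val_runSite_self runSite_apply_of_ne crossings_le iterBlockOf_runSite_mem shift_injective exists_run_start pow_div_pow_le abs_apply_le_of_support delta3_two_mul_nonneg)

variable {d ℓ : ℕ} {m K : ℕ} {hd : 1 ≤ d + 1} {hL : Odd (ℓ + 1) ∧ 1 < ℓ + 1}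
variable {Mh k R : ℕ} {P' : Fin (d + 1) → ℕ}

/-! ## §1  The index bonds of `domT`: levels, the base end-point, the carrier block `β i ∈ 𝔅` -/

section IndexBonds

variable (hN : ∀ μ, N0 ℓ Mh k P' μ = (PV d ℓ m K hd hL).sitesPerDir 0) (D : TDomains d ℓ Mh k P' R) (hk : k ≤ m + K)

/-- the level `j(i)` of an index bond `i = ⟨j, b⟩ ∈ 𝔅` (as a natural number). [cite: Balaban1984PropagatorsII, (2.3)–(2.4) p.224 («Λ_j … the set of bonds»)] -/
abbrev lvl (i : BondIdx (domT hN D hk)) : ℕ := (i.1.1 : ℕ)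

/-- `j(i) ≤ k`. [cite: Balaban1984PropagatorsII, (2.1) p.224] -/
theorem lvl_le (i : BondIdx (domT hN D hk)) : lvl hN D hk i ≤ k := Nat.lt_succ_iff.mp i.1.1.isLt

/-- `j(i) ≤ m + K` (standing range). [cite: Balaban1984PropagatorsII, (2.1) p.224, bookkeeping] -/
theorem lvl_le_mK (i : BondIdx (domT hN D hk)) : lvl hN D hk i ≤ m + K := (lvl_le hN D hk i).trans hk

/- LEVEL-0 TWIN (JOINT J7): the lineage's `one_le_lvl` («no index bond has level 0», from `Ω₁ = T_η`) is NOT twinned — with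
`Λ₀ = T_η ∖ Ω₁ ≠ ∅` the bonds of `Λ₀` ARE index bonds of level `0` (single-site blocks, `Q′₀ = id`); the estimates below treat `j ≤ 1`
by the crude run-length bound and `j ≥ 2` as in the lineage. -/

/-- membership of the source in `Ω_j^{(j)}` is decidable (finite sets). [folklore] -/
instance (i : BondIdx (domT hN D hk)) : Decidable (i.1.2.src ∈ (domT hN D hk).Om (lvl hN D hk i)) := Finset.decidableMem _ _

/-- **THE BASE END-POINT** of an index bond: its source if that lies in `Ω_j^{(j)}`, else its target (one of them does, `LamBond`).
[cite: Balaban1984PropagatorsII, (2.3) p.224 («Λ_j also denotes the set of bonds with at least one end-point in Λ_j»)] -/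
def base (i : BondIdx (domT hN D hk)) : Site (PV d ℓ m K hd hL) (lvl hN D hk i) :=
  if i.1.2.src ∈ (domT hN D hk).Om (lvl hN D hk i) then i.1.2.src else i.1.2.tgt

/-- the other end-point. [cite: Balaban1984PropagatorsII, (2.3) p.224] -/
def other (i : BondIdx (domT hN D hk)) : Site (PV d ℓ m K hd hL) (lvl hN D hk i) :=
  if i.1.2.src ∈ (domT hN D hk).Om (lvl hN D hk i) then i.1.2.tgt else i.1.2.src

/-- the base end-point lies in `Ω_j^{(j)}`. [cite: Balaban1984PropagatorsII, (2.3) p.224] -/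
theorem base_mem (i : BondIdx (domT hN D hk)) : base hN D hk i ∈ (domT hN D hk).Om (lvl hN D hk i) := by
  unfold base
  split_ifs with h
  · exact h
  · exact i.2.1.resolve_left h

/-- the base end-point is not deep. [cite: Balaban1984PropagatorsII, (2.3) p.224] -/
theorem not_deep_base (i : BondIdx (domT hN D hk)) : ¬ (domT hN D hk).Deep (lvl hN D hk i) (base hN D hk i) := by
  unfold base
  split_ifs
  · exact i.2.2.1
  · exact i.2.2.2

/-- the other end-point is not deep. [cite: Balaban1984PropagatorsII, (2.3) p.224] -/
theorem not_deep_other (i : BondIdx (domT hN D hk)) : ¬ (domT hN D hk).Deep (lvl hN D hk i) (other hN D hk i) := by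
  unfold other
  split_ifs
  · exact i.2.2.2
  · exact i.2.2.1

/-- the two end-points are `{base, other} = {src, tgt}`. [cite: Balaban1984PropagatorsII, (2.3) p.224, bookkeeping] -/
theorem ends_eq (i : BondIdx (domT hN D hk)) :
    (base hN D hk i = i.1.2.src ∧ other hN D hk i = i.1.2.tgt) ∨ (base hN D hk i = i.1.2.tgt ∧ other hN D hk i = i.1.2.src) := by
  unfold base other
  split_ifs
  · exact Or.inl ⟨rfl, rfl⟩
  · exact Or.inr ⟨rfl, rfl⟩

/-- a non-deep `j`-block has no fine site of level `≥ j + 1` (the dictionary `Ω_{j+1} ↔ {lev ≥ j + 1}`). [cite: Balaban1984PropagatorsII, (2.1)–(2.4) p.224] -/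
theorem lev_le_of_not_deep {j : ℕ} {y : Site (PV d ℓ m K hd hL) j} (hy : ¬ (B6GlobalChartV1L0.domT hN D hk).Deep j y)
    {x : Site (PV d ℓ m K hd hL) 0} (hx : iterBlockOf j x = y) : D.lev (toBox hN x : Fin (d + 1) → ℤ) ≤ j := by
  by_contra hlt
  have hj1 : j + 1 ≤ D.lev (toBox hN x : Fin (d + 1) → ℤ) := by omega
  have hjk : j + 1 ≤ k := hj1.trans (D.lev_le _)
  apply hy
  unfold B6SectADomainsV1.Domains.Deep
  have h := (iterBlockOf_mem_domT_iff hN D hk hjk x).2 hj1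
  rwa [iterBlockOf_succ, hx] at h

/-- **EVERY FINE SITE OF `B^j(base i)` HAS LEVEL EXACTLY `j`** (`base ∈ Ω_j^{(j)}` gives `≥ j`; non-deep gives `≤ j`). [cite: Balaban1984PropagatorsII, (2.3)–(2.4) p.224 («x ∈ B^j(Λ_j)»)] -/
theorem lev_eq_of_base (i : BondIdx (domT hN D hk)) {x : Site (PV d ℓ m K hd hL) 0}
    (hx : iterBlockOf (lvl hN D hk i) x = base hN D hk i) : D.lev (toBox hN x : Fin (d + 1) → ℤ) = lvl hN D hk i := by
  refine le_antisymm (lev_le_of_not_deep hN D hk (not_deep_base hN D hk i) hx) ?_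
  have h := (iterBlockOf_mem_domT_iff hN D hk (lvl_le hN D hk i) x).1
  rw [hx] at h
  exact h (base_mem hN D hk i)

/-- every fine site of either end block has level `≤ j`. [cite: Balaban1984PropagatorsII, (2.3)–(2.4) p.224] -/
theorem lev_le_of_ends (i : BondIdx (domT hN D hk)) {x : Site (PV d ℓ m K hd hL) 0}
    (hx : iterBlockOf (lvl hN D hk i) x = i.1.2.src ∨ iterBlockOf (lvl hN D hk i) x = i.1.2.tgt) :
    D.lev (toBox hN x : Fin (d + 1) → ℤ) ≤ lvl hN D hk i := by
  rcases hx with hx | hx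
  · exact lev_le_of_not_deep hN D hk i.2.2.1 hx
  · exact lev_le_of_not_deep hN D hk i.2.2.2 hx

/-- a fine site of the base block (blocks are non-empty). [cite: Balaban1984PropagatorsI, (1.18) p.20, bookkeeping] -/
def baseSite (i : BondIdx (domT hN D hk)) : Site (PV d ℓ m K hd hL) 0 :=
  (iterBlock_nonempty (lvl_le_mK hN D hk i) (base hN D hk i)).choose

/-- the chosen site lies in the base block. [cite: Balaban1984PropagatorsI, (1.18) p.20, bookkeeping] -/
theorem iterBlockOf_baseSite (i : BondIdx (domT hN D hk)) : iterBlockOf (lvl hN D hk i) (baseSite hN D hk i) = base hN D hk i := by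
  have h := (iterBlock_nonempty (lvl_le_mK hN D hk i) (base hN D hk i)).choose_spec
  rwa [mem_iterBlock] at h

/-- **THE CARRIER BLOCK `β i ∈ 𝔅`** of an index bond: the block of p21's torus geometry containing (the fine sites of) `B^j(base i)` — print's
«b ∈ Λ_j» read as a block of `𝔅`. [cite: Balaban1984PropagatorsII, (2.45) p.231 («𝔅 = ⋃_j Λ_j»), (2.142) p.248 («b ∈ Λ_j»)] -/
def β (i : BondIdx (domT hN D hk)) : ↥(bset D.toDomains) := blkOf D.toDomains (toBox hN (baseSite hN D hk i))

/-- the level of `β i` is `j(i)`. [cite: Balaban1984PropagatorsII, (2.45) p.231] -/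
theorem beta_level (i : BondIdx (domT hN D hk)) : (β hN D hk i).1.1 = lvl hN D hk i := by
  unfold β
  rw [blkOf_val]
  exact lev_eq_of_base hN D hk i (iterBlockOf_baseSite hN D hk i)

/-- **`B^j(base i)` IS THE BLOCK `β i`**: every fine site of it has `blkOf = β i`. [cite: Balaban1984PropagatorsII, (2.45) p.231, p.231 («x ∈ B^j(y)»)] -/
theorem blkOf_eq_beta (i : BondIdx (domT hN D hk)) {x : Site (PV d ℓ m K hd hL) 0}
    (hx : iterBlockOf (lvl hN D hk i) x = base hN D hk i) : blkOf D.toDomains (toBox hN x) = β hN D hk i := by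
  unfold β
  rw [blkOf_toBox_eq_iff hN D hk, lev_eq_of_base hN D hk i (iterBlockOf_baseSite hN D hk i), hx, iterBlockOf_baseSite]

/-- in particular `blkV1` of a fine bond issuing from `B^j(base i)` is `β i`. [cite: Balaban1984PropagatorsII, (2.45) p.231] -/
theorem blkV1_eq_beta (i : BondIdx (domT hN D hk)) {f : PBond (PV d ℓ m K hd hL) 0}
    (hf : iterBlockOf (lvl hN D hk i) f.src = base hN D hk i) : blkV1 hN D f = β hN D hk i :=
  blkOf_eq_beta hN D hk i hf

end IndexBonds

/-! ## §1b  The fine sites of the double block: torus-close to the base block, hence of level `≥ j − 1` ((2.2) `sepT`) -/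

section Near

variable (hN : ∀ μ, N0 ℓ Mh k P' μ = (PV d ℓ m K hd hL).sitesPerDir 0) (D : TDomains d ℓ Mh k P' R) (hk : k ≤ m + K)

/-- equal quotients by `n`: the labels differ by less than `n`. [folklore] -/
private theorem sub_lt_of_div_eq' {a b n : ℕ} (hn : 0 < n) (h : a / n = b / n) : ((a : ℤ) - b) < n ∧ ((b : ℤ) - a) < n := by
  have h1 := Nat.lt_div_mul_add (a := a) hn
  have h2 := Nat.div_mul_le_self b n
  have h3 := Nat.lt_div_mul_add (a := b) hn
  have h4 := Nat.div_mul_le_self a n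
  rw [h] at h1 h4
  constructor <;> omega

/-- **EVERY FINE SITE OF THE DOUBLE BLOCK `B^j(y) ∪ B^j(y + e_μ)` IS WITHIN TORUS DISTANCE `2L^j` OF THE BASE SITE.**
[cite: Balaban1984PropagatorsII, (2.45) p.231; Balaban1984PropagatorsI, (1.18) p.20 («x(b) is a point in B^k(b₊)»), dictionary] -/
theorem near_base (i : BondIdx (domT hN D hk)) {x : Site (PV d ℓ m K hd hL) 0}
    (hx : iterBlockOf (lvl hN D hk i) x = i.1.2.src ∨ iterBlockOf (lvl hN D hk i) x = i.1.2.tgt) :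
    torusSupNorm (N0 ℓ Mh k P') ((toBox hN (baseSite hN D hk i)).1 - (toBox hN x).1) < 2 * (((ℓ + 1 : ℕ) : ℝ)) ^ (lvl hN D hk i) := by
  have hjm := lvl_le_mK hN D hk i
  have hb := iterBlockOf_baseSite hN D hk i
  have hLn : (0 : ℝ) < (((ℓ + 1 : ℕ) : ℝ)) ^ (lvl hN D hk i) := by positivity
  -- same block as the base: `< L^j`
  have same : ∀ {z : Site (PV d ℓ m K hd hL) 0}, iterBlockOf (lvl hN D hk i) z = base hN D hk i →
      torusSupNorm (N0 ℓ Mh k P') ((toBox hN (baseSite hN D hk i)).1 - (toBox hN z).1) < 2 * (((ℓ + 1 : ℕ) : ℝ)) ^ (lvl hN D hk i) :=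
    fun hz => lt_of_lt_of_le (torusSupNorm_lt_of_block_eq hN hjm (hz.trans hb.symm)) (by linarith)
  rcases ends_eq hN D hk i with ⟨hbs, hot⟩ | ⟨hbt, hos⟩
  · rcases hx with hx | hx
    · exact same (hx.trans hbs.symm)
    · -- `x` in the target block, base = source: the shift lemma with `x := baseSite`, `x′ := x`
      have h' : iterBlockOf (lvl hN D hk i) x = (iterBlockOf (lvl hN D hk i) (baseSite hN D hk i)).shift i.1.2.dir := by
        rw [hb, hbs, hx]; rfl
      exact torusSupNorm_lt_of_block_shift hN hjm h'
  · rcases hx with hx | hx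
    · -- `x` in the source block, base = target
      have h' : iterBlockOf (lvl hN D hk i) (baseSite hN D hk i) = (iterBlockOf (lvl hN D hk i) x).shift i.1.2.dir := by
        rw [hb, hbt, hx]; rfl
      have h := torusSupNorm_lt_of_block_shift hN hjm h'
      rwa [show (toBox hN x).1 - (toBox hN (baseSite hN D hk i)).1 = -((toBox hN (baseSite hN D hk i)).1 - (toBox hN x).1) by abel,
        torusSupNorm_neg (one_le_N0 hN)] at h
    · exact same (hx.trans hbt.symm)

/-- **THE DOUBLE BLOCK HAS LEVEL `≥ j − 1`** ((2.2) on the torus, `B6MultiLevelTorusOperatorL0.TDomains.sepT (j − 1)`: a site of level `≤ j − 2` is farther than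
`R·M_h·L^j ≥ 2L^j` from the base site, which has level `j`). [cite: Balaban1984PropagatorsII, (2.2) p.224] -/
theorem pred_le_lev_of_ends (hRM : 2 ≤ R * Mh) (i : BondIdx (domT hN D hk)) {x : Site (PV d ℓ m K hd hL) 0}
    (hx : iterBlockOf (lvl hN D hk i) x = i.1.2.src ∨ iterBlockOf (lvl hN D hk i) x = i.1.2.tgt) :
    lvl hN D hk i - 1 ≤ D.lev (toBox hN x : Fin (d + 1) → ℤ) := by
  -- LEVEL-0 TWIN (J7): for a level-0 index bond the claim is `0 ≤ lev`
  rcases Nat.eq_zero_or_pos (lvl hN D hk i) with hj0 | hj1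
  · rw [hj0]; exact Nat.zero_le _
  by_contra hlt
  have hlevb : D.lev (toBox hN (baseSite hN D hk i) : Fin (d + 1) → ℤ) = lvl hN D hk i :=
    lev_eq_of_base hN D hk i (iterBlockOf_baseSite hN D hk i)
  have hsep := D.sepT (lvl hN D hk i - 1) (toBox hN x).1 (toBox hN x).2 (toBox hN (baseSite hN D hk i)).1 (toBox hN (baseSite hN D hk i)).2
    (by omega) (by rw [hlevb]; omega)
  have hnear := near_base hN D hk i hx
  rw [show (toBox hN (baseSite hN D hk i)).1 - (toBox hN x).1 = -((toBox hN x).1 - (toBox hN (baseSite hN D hk i)).1) by abel,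
    torusSupNorm_neg (one_le_N0 hN)] at hnear
  -- `R·bigSide(j−1) = R·M_h·L^j ≥ 2L^j`
  have hbig : 2 * (((ℓ + 1 : ℕ) : ℝ)) ^ (lvl hN D hk i) ≤ ((R * bigSide ℓ Mh (lvl hN D hk i - 1) : ℕ) : ℝ) := by
    unfold bigSide
    rw [show lvl hN D hk i - 1 + 1 = lvl hN D hk i by omega]
    have h2 : ((2 : ℕ) : ℝ) ≤ ((R * Mh : ℕ) : ℝ) := by exact_mod_cast hRM
    have hpos : (0 : ℝ) ≤ (((ℓ + 1 : ℕ) : ℝ)) ^ (lvl hN D hk i) := by positivity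
    calc 2 * (((ℓ + 1 : ℕ) : ℝ)) ^ (lvl hN D hk i) = ((2 : ℕ) : ℝ) * (((ℓ + 1 : ℕ) : ℝ)) ^ (lvl hN D hk i) := by norm_num
      _ ≤ ((R * Mh : ℕ) : ℝ) * (((ℓ + 1 : ℕ) : ℝ)) ^ (lvl hN D hk i) := mul_le_mul_of_nonneg_right h2 hpos
      _ = ((R * (Mh * (ℓ + 1) ^ (lvl hN D hk i)) : ℕ) : ℝ) := by push_cast; ring
  linarith

/-- the level of a fine site of the double block is `j` or `j − 1`. [cite: Balaban1984PropagatorsII, (2.2)–(2.4) p.224] -/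
theorem lev_ends_bounds (hRM : 2 ≤ R * Mh) (i : BondIdx (domT hN D hk)) {x : Site (PV d ℓ m K hd hL) 0}
    (hx : iterBlockOf (lvl hN D hk i) x = i.1.2.src ∨ iterBlockOf (lvl hN D hk i) x = i.1.2.tgt) :
    lvl hN D hk i - 1 ≤ D.lev (toBox hN x : Fin (d + 1) → ℤ) ∧ D.lev (toBox hN x : Fin (d + 1) → ℤ) ≤ lvl hN D hk i :=
  ⟨pred_le_lev_of_ends hN D hk hRM i hx, lev_le_of_ends hN D hk i hx⟩

end Near

/-! ## §2  The averaging weights of an index bond ([Balaban1984PropagatorsI] (1.18)) and the flat matrix `X = QGQ*` -/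

section Weights

variable (hN : ∀ μ, N0 ℓ Mh k P' μ = (PV d ℓ m K hd hL).sitesPerDir 0) (D : TDomains d ℓ Mh k P' R) (hk : k ≤ m + K)

/-- **(1.18) FOR THE INDEX BOND `i`**: `(Qv)_i = L^{−j(D+1)} Σ_{x ∈ B^j(y)} Σ_{t < L^j} v([x + te_μ, x + (t+1)e_μ])`.
[cite: Balaban1984PropagatorsI, (1.18) p.20; Balaban1984PropagatorsII, (2.20) p.226] -/
theorem QE_apply_eq_sum (i : BondIdx (domT hN D hk)) (v : BondSpace (PV d ℓ m K hd hL)) :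
    QE (domT hN D hk) v i = cQ (d := d) (ℓ := ℓ) (lvl hN D hk i) *
      ∑ x ∈ iterBlock (lvl hN D hk i) i.1.2.src, ∑ t ∈ Finset.range ((ℓ + 1) ^ (lvl hN D hk i)), v (runBond x i.1.2.dir t) := by
  rw [B6SectAOperatorsV1.QE_apply, bondAvgIter_eq_blockSum _ (lvl_le_mK hN D hk i), smul_eq_mul, cQ_eq]
  rfl

/-- `|(Qv)_i| ≤ S` if `|v| ≤ S` on the fine bonds of the straight contours of `i` (an average). [cite: Balaban1984PropagatorsI, (1.18) p.20] -/
theorem abs_QE_apply_le (i : BondIdx (domT hN D hk)) (v : BondSpace (PV d ℓ m K hd hL)) {S : ℝ}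
    (hS : ∀ x ∈ iterBlock (lvl hN D hk i) i.1.2.src, ∀ t < (ℓ + 1) ^ (lvl hN D hk i), |v (runBond x i.1.2.dir t)| ≤ S) :
    |QE (domT hN D hk) v i| ≤ S := by
  rw [QE_apply_eq_sum]
  have hc := cQ_pos (d := d) (ℓ := ℓ) (lvl hN D hk i)
  have hcard : (iterBlock (lvl hN D hk i) i.1.2.src).card = ((ℓ + 1) ^ (d + 1)) ^ (lvl hN D hk i) :=
    B5Eq118OneStroke.card_iterBlock _ (lvl_le_mK hN D hk i) _
  rw [abs_mul, abs_of_pos hc]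
  have hsum : |∑ x ∈ iterBlock (lvl hN D hk i) i.1.2.src, ∑ t ∈ Finset.range ((ℓ + 1) ^ (lvl hN D hk i)), v (runBond x i.1.2.dir t)|
      ≤ ((((ℓ + 1) ^ (d + 1)) ^ (lvl hN D hk i) : ℕ) : ℝ) * ((((ℓ + 1) ^ (lvl hN D hk i) : ℕ) : ℝ) * S) := by
    rw [← hcard]
    refine (Finset.abs_sum_le_sum_abs _ _).trans ?_
    have : ∀ x ∈ iterBlock (lvl hN D hk i) i.1.2.src,
        |∑ t ∈ Finset.range ((ℓ + 1) ^ (lvl hN D hk i)), v (runBond x i.1.2.dir t)| ≤ (((ℓ + 1) ^ (lvl hN D hk i) : ℕ) : ℝ) * S := by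
      intro x hx
      refine (Finset.abs_sum_le_sum_abs _ _).trans ?_
      have := Finset.sum_le_sum fun t (ht : t ∈ Finset.range ((ℓ + 1) ^ (lvl hN D hk i))) => hS x hx t (Finset.mem_range.1 ht)
      refine this.trans ?_
      rw [Finset.sum_const, Finset.card_range, nsmul_eq_mul]
    refine (Finset.sum_le_sum this).trans ?_
    rw [Finset.sum_const, nsmul_eq_mul]
  refine (mul_le_mul_of_nonneg_left hsum hc.le).trans (le_of_eq ?_)
  rw [← mul_assoc, ← mul_assoc, mul_assoc (cQ _), cQ_mul_card, one_mul]

/-- the weight of the fine bond `f` in `(Q·)_i`: `q_i(f) = (Q e_f)_i = ⟪Q*e_i, e_f⟫`. [cite: Balaban1984PropagatorsI, (1.18) p.20; Balaban1984PropagatorsII, (2.18) p.226 («Q*»)] -/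
def qwt (i : BondIdx (domT hN D hk)) (f : PBond (PV d ℓ m K hd hL) 0) : ℝ :=
  QE (domT hN D hk) (EuclideanSpace.single f (1 : ℝ)) i

/-- **`Q*e_i` IS THE WEIGHT FUNCTION `q_i`**: `(Q*e_i)(f) = q_i(f)`. [cite: Balaban1984PropagatorsII, (2.18) p.226 («Q*»)] -/
theorem QsE_single_apply (i : BondIdx (domT hN D hk)) (f : PBond (PV d ℓ m K hd hL) 0) :
    QsE (domT hN D hk) (EuclideanSpace.single i (1 : ℝ)) f = qwt hN D hk i f := by
  have h := inner_QsE_left (D := domT hN D hk) (EuclideanSpace.single i (1 : ℝ)) (EuclideanSpace.single f (1 : ℝ))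
  rw [real_inner_comm, EuclideanSpace.inner_single_left, EuclideanSpace.inner_single_left] at h
  simpa [qwt] using h

/-- the weight as the normalised pair count: `q_i(f) = L^{−j(D+1)}·Σ_{x,t} [runBond x μ t = f]`. [cite: Balaban1984PropagatorsI, (1.18) p.20] -/
theorem qwt_eq_sum (i : BondIdx (domT hN D hk)) (f : PBond (PV d ℓ m K hd hL) 0) :
    qwt hN D hk i f = cQ (d := d) (ℓ := ℓ) (lvl hN D hk i) *
      ∑ x ∈ iterBlock (lvl hN D hk i) i.1.2.src, ∑ t ∈ Finset.range ((ℓ + 1) ^ (lvl hN D hk i)),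
        (if runBond x i.1.2.dir t = f then (1 : ℝ) else 0) := by
  unfold qwt
  rw [QE_apply_eq_sum]
  congr 1
  refine Finset.sum_congr rfl fun x _ => Finset.sum_congr rfl fun t _ => ?_
  rw [PiLp.single_apply]

/-- `q_i ≥ 0`. [cite: Balaban1984PropagatorsI, (1.18) p.20] -/
theorem qwt_nonneg (i : BondIdx (domT hN D hk)) (f : PBond (PV d ℓ m K hd hL) 0) : 0 ≤ qwt hN D hk i f := by
  rw [qwt_eq_sum]
  exact mul_nonneg (cQ_pos _).le (Finset.sum_nonneg fun x _ => Finset.sum_nonneg fun t _ => by split_ifs <;> norm_num)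

/-- **`q_i ≤ L^{−jD}`**: each fine bond is the `t`-th bond of the contour from at most ONE site per `t` (so at most `L^j` of the `L^{j(D+1)}` pairs
`(x, t)` hit it). [cite: Balaban1984PropagatorsI, (1.18) p.20] -/
theorem qwt_le (i : BondIdx (domT hN D hk)) (f : PBond (PV d ℓ m K hd hL) 0) :
    qwt hN D hk i f ≤ ((((ℓ + 1 : ℕ) : ℝ) ^ (d + 1)) ^ (lvl hN D hk i))⁻¹ := by
  classical
  rw [qwt_eq_sum, Finset.sum_comm]
  set j := lvl hN D hk i
  have hjm := lvl_le_mK hN D hk i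
  -- for each `t`, at most one `x` with `runBond x μ t = f`
  have hinner : ∀ t ∈ Finset.range ((ℓ + 1) ^ j),
      ∑ x ∈ iterBlock j i.1.2.src, (if runBond x i.1.2.dir t = f then (1 : ℝ) else 0) ≤ 1 := by
    intro t _
    rw [← Finset.sum_filter, Finset.sum_const, nsmul_eq_mul, mul_one]
    have : ((iterBlock j i.1.2.src).filter fun x => runBond x i.1.2.dir t = f).card ≤ 1 := by
      refine Finset.card_le_one.2 fun x hx x' hx' => ?_
      rw [Finset.mem_filter] at hx hx'
      have h1 := congrArg PBond.src (hx.2.trans hx'.2.symm)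
      change runSite x i.1.2.dir t = runSite x' i.1.2.dir t at h1
      funext ν
      have hν := congrFun h1 ν
      by_cases hνμ : ν = i.1.2.dir
      · subst hνμ
        simpa [runSite] using hν
      · simpa [runSite, Function.update_of_ne hνμ] using hν
    exact_mod_cast this
  have hc := cQ_pos (d := d) (ℓ := ℓ) j
  calc cQ (d := d) (ℓ := ℓ) j * ∑ t ∈ Finset.range ((ℓ + 1) ^ j), ∑ x ∈ iterBlock j i.1.2.src, (if runBond x i.1.2.dir t = f then (1 : ℝ) else 0)
      ≤ cQ (d := d) (ℓ := ℓ) j * ∑ t ∈ Finset.range ((ℓ + 1) ^ j), (1 : ℝ) :=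
        mul_le_mul_of_nonneg_left (Finset.sum_le_sum hinner) hc.le
    _ = ((((ℓ + 1 : ℕ) : ℝ) ^ (d + 1)) ^ j)⁻¹ := by
        rw [Finset.sum_const, Finset.card_range, nsmul_eq_mul, mul_one]
        unfold cQ
        have hb : ((((ℓ + 1 : ℕ) : ℝ)) ^ j) ≠ 0 := by positivity
        rw [Nat.cast_pow, mul_assoc, inv_mul_cancel₀ hb, mul_one]

/-- **THE SUPPORT OF `q_i`**: a fine bond with non-zero weight is a bond `[x + te_μ, x + (t+1)e_μ]` of a straight contour of `i`
(`x ∈ B^j(y)`, `t < L^j`). [cite: Balaban1984PropagatorsI, (1.18) p.20] -/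
theorem exists_of_qwt_ne_zero (i : BondIdx (domT hN D hk)) {f : PBond (PV d ℓ m K hd hL) 0} (hf : qwt hN D hk i f ≠ 0) :
    ∃ x ∈ iterBlock (lvl hN D hk i) i.1.2.src, ∃ t < (ℓ + 1) ^ (lvl hN D hk i), runBond x i.1.2.dir t = f := by
  rw [qwt_eq_sum] at hf
  have h := right_ne_zero_of_mul hf
  obtain ⟨x, hx, hx'⟩ := Finset.exists_ne_zero_of_sum_ne_zero h
  obtain ⟨t, ht, ht'⟩ := Finset.exists_ne_zero_of_sum_ne_zero hx'
  refine ⟨x, hx, t, Finset.mem_range.1 ht, ?_⟩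
  by_contra hne
  exact ht' (if_neg hne)

/-- **THE FLAT MATRIX OF `QGQ*`**: `X(i, i′) = ⟪e_i, QGQ*e_{i′}⟫` on the index bonds. [cite: Balaban1984PropagatorsII, (2.142) p.248 («the operator QGQ*»), (2.35) p.228] -/
def X {cf : ℝ} (hcf : cf ≠ 0) {w : BondIdx (domT hN D hk) → ℝ} (hw : ∀ i, 0 < w i) (i i' : BondIdx (domT hN D hk)) : ℝ :=
  QE (domT hN D hk) (GE (domT hN D hk) hcf hw (QsE (domT hN D hk) (EuclideanSpace.single i' (1 : ℝ)))) i

/-- `X(i, i′)` is the inner product `⟪e_i, QGQ*e_{i′}⟫`. [cite: Balaban1984PropagatorsII, (2.142) p.248, bookkeeping] -/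
theorem X_eq_inner {cf : ℝ} (hcf : cf ≠ 0) {w : BondIdx (domT hN D hk) → ℝ} (hw : ∀ i, 0 < w i) (i i' : BondIdx (domT hN D hk)) :
    X hN D hk hcf hw i i' = ⟪EuclideanSpace.single i (1 : ℝ),
      QE (domT hN D hk) (GE (domT hN D hk) hcf hw (QsE (domT hN D hk) (EuclideanSpace.single i' (1 : ℝ))))⟫_ℝ := by
  rw [EuclideanSpace.inner_single_left]; simp [X]

/-- **`X` IS SYMMETRIC** (`G` is symmetric, `Q*` is the adjoint of `Q`). [cite: Balaban1984PropagatorsII, p.248 («The operator QGQ* is positive»), (2.22) p.226] -/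
theorem X_symm {cf : ℝ} (hcf : cf ≠ 0) {w : BondIdx (domT hN D hk) → ℝ} (hw : ∀ i, 0 < w i) (i i' : BondIdx (domT hN D hk)) :
    X hN D hk hcf hw i i' = X hN D hk hcf hw i' i := by
  rw [X_eq_inner, X_eq_inner, ← inner_QsE_left, ← inner_GE_left, real_inner_comm, ← inner_QsE_left, real_inner_comm]

/-- **`X(i, i′)` AS AN AVERAGE OF `G q_{i′}` OVER THE CONTOURS OF `i`**: `X(i,i′) = L^{−j(D+1)}Σ_{x,t} (onFun G q_{i′})([x+te_μ, …])`.
[cite: Balaban1984PropagatorsI, (1.18) p.20; Balaban1984PropagatorsII, (2.142) p.248] -/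
theorem X_eq_sum {cf : ℝ} (hcf : cf ≠ 0) {w : BondIdx (domT hN D hk) → ℝ} (hw : ∀ i, 0 < w i) (i i' : BondIdx (domT hN D hk)) :
    X hN D hk hcf hw i i' = cQ (d := d) (ℓ := ℓ) (lvl hN D hk i) *
      ∑ x ∈ iterBlock (lvl hN D hk i) i.1.2.src, ∑ t ∈ Finset.range ((ℓ + 1) ^ (lvl hN D hk i)),
        onFun (GE (domT hN D hk) hcf hw) (qwt hN D hk i') (runBond x i.1.2.dir t) := by
  have hq : QsE (domT hN D hk) (EuclideanSpace.single i' (1 : ℝ)) = WithLp.toLp 2 (qwt hN D hk i') :=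
    PiLp.ext fun f => by rw [QsE_single_apply, WithLp.ofLp_toLp]
  unfold X
  rw [QE_apply_eq_sum, hq]
  rfl

end Weights

/-! ## §3  The geometry of the double block in the torus distance (2.46) -/

section Geometry

variable (hN : ∀ μ, N0 ℓ Mh k P' μ = (PV d ℓ m K hd hL).sitesPerDir 0) (D : TDomains d ℓ Mh k P' R) (hk : k ≤ m + K)

include hk in
/-- **TWO FINE SITES OF LEVEL `≥ n` IN ONE `n`-BLOCK LIE IN THE SAME BLOCK OF `𝔅`** (their levels agree — `Ω_{n′} ↔ {lev ≥ n′}` is read on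
`n′`-blocks — and so do their blocks at that level). [cite: Balaban1984PropagatorsII, (2.1)–(2.4) p.224, (2.45) p.231] -/
theorem blkOf_eq_of_sameBlock {n : ℕ} {x x' : Site (PV d ℓ m K hd hL) 0}
    (hx : n ≤ D.lev (toBox hN x : Fin (d + 1) → ℤ)) (hx' : n ≤ D.lev (toBox hN x' : Fin (d + 1) → ℤ))
    (he : iterBlockOf n x = iterBlockOf n x') : blkOf D.toDomains (toBox hN x) = blkOf D.toDomains (toBox hN x') := by
  -- the levels agree
  have hle : ∀ {z z' : Site (PV d ℓ m K hd hL) 0}, n ≤ D.lev (toBox hN z : Fin (d + 1) → ℤ) → n ≤ D.lev (toBox hN z' : Fin (d + 1) → ℤ) →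
      iterBlockOf n z = iterBlockOf n z' → D.lev (toBox hN z : Fin (d + 1) → ℤ) ≤ D.lev (toBox hN z' : Fin (d + 1) → ℤ) := by
    intro z z' hz _ hzz
    have hk' : D.lev (toBox hN z : Fin (d + 1) → ℤ) ≤ k := D.lev_le _
    have hmem := (iterBlockOf_mem_domT_iff hN D hk hk' z).2 le_rfl
    rw [iterBlockOf_eq_of_le hz hzz] at hmem
    exact (iterBlockOf_mem_domT_iff hN D hk hk' z').1 hmem
  have hlev : D.lev (toBox hN x : Fin (d + 1) → ℤ) = D.lev (toBox hN x' : Fin (d + 1) → ℤ) :=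
    le_antisymm (hle hx hx' he) (hle hx' hx he.symm)
  rw [blkOf_toBox_eq_iff hN D hk x' x]
  exact iterBlockOf_eq_of_le (by rw [← hlev]; exact hx) he

include hk in
/-- **BLOCKS OF `𝔅` CHANGE ALONG `e_μ` ONLY AT MULTIPLES OF `L^n`** (sites of level `≥ n`). [cite: Balaban1984PropagatorsII, (2.45) p.231, (2.1) p.224] -/
theorem blkOf_shift_eq {n : ℕ} (hn : n ≤ m + K) (x : Site (PV d ℓ m K hd hL) 0) (μ : Fin (d + 1))
    (hx : n ≤ D.lev (toBox hN x : Fin (d + 1) → ℤ)) (hx' : n ≤ D.lev (toBox hN (x.shift μ) : Fin (d + 1) → ℤ))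
    (hnd : ¬ (ℓ + 1) ^ n ∣ ((x.shift μ) μ).val) :
    blkOf D.toDomains (toBox hN (x.shift μ)) = blkOf D.toDomains (toBox hN x) :=
  blkOf_eq_of_sameBlock hN D hk hx' hx (iterBlockOf_shift_eq hn x μ hnd)

/-- **NEIGHBOURING SITES HAVE EQUAL OR ADJACENT BLOCKS** (torus distance `≤ 1`, the admissible bonds (2.46)). [cite: Balaban1984PropagatorsII, (2.46) p.231] -/
theorem distT_shift_le_one (x : Site (PV d ℓ m K hd hL) 0) (μ : Fin (d + 1)) :
    (B6Geom246MultiLevelTorusL0.bondT D).dist (blkOf D.toDomains (toBox hN x)) (blkOf D.toDomains (toBox hN (x.shift μ))) ≤ 1 := by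
  by_cases he : blkOf D.toDomains (toBox hN x) = blkOf D.toDomains (toBox hN (x.shift μ))
  · rw [he, SimpleGraph.dist_self]; exact zero_le_one
  · have ht : TouchT D (blkOf D.toDomains (toBox hN x)) (blkOf D.toDomains (toBox hN (x.shift μ))) := by
      refine ⟨toBox hN x, toBox hN (x.shift μ), rfl, rfl, ?_⟩
      have h := torusSupNorm_tshift_unitVec_le (one_le_N0 hN) μ (toBox hN x)
      rw [← toBox_shift hN] at h
      rwa [show (toBox hN x).1 - (toBox hN (x.shift μ)).1 = -((toBox hN (x.shift μ)).1 - (toBox hN x).1) by abel,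
        torusSupNorm_neg (one_le_N0 hN)]
    rw [SimpleGraph.dist_eq_one_iff_adj.2 (bondT_adj.2 ⟨he, ht⟩)]

/-- **THE CRUDE RUN BOUND** (LEVEL-0 TWIN, J7): along a straight run of `T` steps the block of `𝔅` moves by at most `T`
(`distT_shift_le_one` each step) — used for the index bonds of level `≤ 1`, whose double block may meet `Λ₀`.
[cite: Balaban1984PropagatorsII, (2.46) p.231] -/
theorem distT_run_le_length (hMh : 1 ≤ Mh) (hP : ∀ μ, 1 ≤ P' μ) (x : Site (PV d ℓ m K hd hL) 0) (μ : Fin (d + 1)) : ∀ T : ℕ,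
    (B6Geom246MultiLevelTorusL0.bondT D).dist (blkOf D.toDomains (toBox hN x)) (blkOf D.toDomains (toBox hN (runSite x μ T))) ≤ T
  | 0 => by simp [runSite]
  | T + 1 => by
    have ih := distT_run_le_length hMh hP x μ T
    have hconn := B6Geom246MultiLevelTorusL0.connectedT (D := D) hMh hP
    have htri := hconn.dist_triangle (u := blkOf D.toDomains (toBox hN x)) (v := blkOf D.toDomains (toBox hN (runSite x μ T)))
      (w := blkOf D.toDomains (toBox hN (runSite x μ (T + 1))))
    have h1 := distT_shift_le_one hN D (runSite x μ T) μ
    rw [← runSite_succ x μ T] at h1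
    omega

include hk in
/-- **THE RUN LEMMA**: along a straight run of `T` steps through sites of level `≥ n`, the block of `𝔅` moves by at most the number of
crossings of multiples of `L^n`. [cite: Balaban1984PropagatorsII, (2.46) p.231 («d(y, y′) = inf Σ (L^{j(Γ_i)}η)^{−1}|Γ_i|»)] -/
theorem distT_run_le (hMh : 1 ≤ Mh) (hP : ∀ μ, 1 ≤ P' μ) {n : ℕ} (hn : n ≤ m + K)
    (x : Site (PV d ℓ m K hd hL) 0) (μ : Fin (d + 1)) : ∀ T : ℕ,
    (∀ t ≤ T, n ≤ D.lev (toBox hN (runSite x μ t) : Fin (d + 1) → ℤ)) →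
    (bondT D).dist (blkOf D.toDomains (toBox hN x)) (blkOf D.toDomains (toBox hN (runSite x μ T))) ≤ crossings n x μ T
  | 0, _ => by simp [crossings]
  | T + 1, hlev => by
    have ih := distT_run_le hMh hP hn x μ T fun t ht => hlev t (Nat.le_succ_of_le ht)
    have hconn := B6Geom246MultiLevelTorusL0.connectedT (D := D) hMh hP
    have htri := hconn.dist_triangle (u := blkOf D.toDomains (toBox hN x)) (v := blkOf D.toDomains (toBox hN (runSite x μ T)))
      (w := blkOf D.toDomains (toBox hN (runSite x μ (T + 1))))
    rw [crossings, Finset.sum_range_succ, ← crossings]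
    have hsucc : runSite x μ (T + 1) = (runSite x μ T).shift μ := runSite_succ x μ T
    by_cases hdvd : (ℓ + 1) ^ n ∣ ((runSite x μ (T + 1)) μ).val
    · rw [if_pos hdvd]
      have h1 := distT_shift_le_one hN D (runSite x μ T) μ
      rw [← hsucc] at h1
      omega
    · rw [if_neg hdvd, add_zero]
      have h0 : blkOf D.toDomains (toBox hN (runSite x μ (T + 1))) = blkOf D.toDomains (toBox hN (runSite x μ T)) := by
        rw [hsucc] at hdvd ⊢
        exact blkOf_shift_eq hN D hk hn (runSite x μ T) μ (hlev T (Nat.le_succ T)) (by rw [← hsucc]; exact hlev (T + 1) le_rfl) hdvd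
      rw [h0]
      exact ih

/-- **EVERY BLOCK OF `𝔅` MET BY THE DOUBLE BLOCK OF `i` IS WITHIN GRAPH DISTANCE `L + 2` OF THE CARRIER BLOCK `β i`**.
[cite: Balaban1984PropagatorsII, (2.46) p.231, (2.142) p.248 («b ∈ Λ_j»)] -/
theorem distT_ends_le (hRM : 2 ≤ R * Mh) (hMh : 1 ≤ Mh) (hP : ∀ μ, 1 ≤ P' μ) (i : BondIdx (domT hN D hk))
    {x : Site (PV d ℓ m K hd hL) 0} (hx : iterBlockOf (lvl hN D hk i) x = i.1.2.src ∨ iterBlockOf (lvl hN D hk i) x = i.1.2.tgt) :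
    (bondT D).dist (β hN D hk i) (blkOf D.toDomains (toBox hN x)) ≤ ℓ + 3 := by
  set j := lvl hN D hk i with hjdef
  have hjm : j ≤ m + K := lvl_le_mK hN D hk i
  have htgt : i.1.2.tgt = i.1.2.src.shift i.1.2.dir := rfl
  -- the run bound from a site of `B^j(src)` to its translate by `L^j e_μ`
  have hrun : ∀ {x' : Site (PV d ℓ m K hd hL) 0}, iterBlockOf j x' = i.1.2.src →
      (bondT D).dist (blkOf D.toDomains (toBox hN x')) (blkOf D.toDomains (toBox hN (runSite x' i.1.2.dir ((ℓ + 1) ^ j)))) ≤ ℓ + 3 := by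
    intro x' hx'
    by_cases hj2 : 2 ≤ j
    · -- levels `≥ j − 1 ≥ 1` along runs inside the double block ((2.2) only — LEVEL-0 TWIN: no `one_le_lev`)
      set n := max (j - 1) 1 with hndef
      have hnm : n ≤ m + K := by omega
      have hlevn : ∀ {z : Site (PV d ℓ m K hd hL) 0}, (iterBlockOf j z = i.1.2.src ∨ iterBlockOf j z = i.1.2.tgt) →
          n ≤ D.lev (toBox hN z : Fin (d + 1) → ℤ) := by
        intro z hz
        have h1 := pred_le_lev_of_ends hN D hk hRM i hz
        exact max_le h1 (by omega)
      have hl : ∀ t ≤ (ℓ + 1) ^ j, n ≤ D.lev (toBox hN (runSite x' i.1.2.dir t) : Fin (d + 1) → ℤ) := by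
        intro t ht
        refine hlevn ?_
        rcases iterBlockOf_runSite_mem hjm x' i.1.2.dir ht with h | h
        · exact Or.inl (h.trans hx')
        · right; rw [h, hx', htgt]
      refine (distT_run_le hN D hk hMh hP hnm x' i.1.2.dir ((ℓ + 1) ^ j) hl).trans ?_
      refine (crossings_le hnm x' i.1.2.dir _).trans ?_
      have := pow_div_pow_le (ℓ := ℓ) j
      rw [← hndef] at this
      omega
    · -- LEVEL-0 TWIN (J7): `j ≤ 1` — the run has `L^j ≤ L` steps, each moving the block by `≤ 1`
      refine (distT_run_le_length hN D hMh hP x' i.1.2.dir ((ℓ + 1) ^ j)).trans ?_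
      have h1 : (ℓ + 1) ^ j ≤ (ℓ + 1) ^ 1 := Nat.pow_le_pow_right (Nat.succ_pos ℓ) (by omega)
      rw [pow_one] at h1
      omega
  by_cases hb : iterBlockOf j x = base hN D hk i
  · rw [blkOf_eq_beta hN D hk i hb, SimpleGraph.dist_self]; exact Nat.zero_le _
  · rcases ends_eq hN D hk i with ⟨hbs, hot⟩ | ⟨hbt, hos⟩
    · -- base = src; `x` lies in the target block: run backwards
      have hxt : iterBlockOf j x = i.1.2.tgt := by
        rcases hx with hx | hx
        · exact absurd (hx.trans hbs.symm) hb
        · exact hx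
      rw [htgt] at hxt
      obtain ⟨x', hx', hrx⟩ := exists_run_start hjm (μ := i.1.2.dir) hxt
      have h := hrun hx'
      rw [hrx, blkOf_eq_beta hN D hk i (hx'.trans hbs.symm)] at h
      exact h
    · -- base = tgt; `x` lies in the source block: run forwards
      have hxs : iterBlockOf j x = i.1.2.src := by
        rcases hx with hx | hx
        · exact hx
        · exact absurd (hx.trans hbt.symm) hb
      have hend : iterBlockOf j (runSite x i.1.2.dir ((ℓ + 1) ^ j)) = i.1.2.tgt := by
        have := runSite_mem_iterBlock_tgt (P := PV d ℓ m K hd hL) hjm (b := i.1.2) (x := x) (by rw [mem_iterBlock]; exact hxs)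
        rwa [mem_iterBlock] at this
      have h := hrun hxs
      rw [blkOf_eq_beta hN D hk i (hend.trans hbt.symm)] at h
      rw [SimpleGraph.dist_comm]
      exact h

/-- the same bound in p21's real-valued torus geometry `geomT D`. [cite: Balaban1984PropagatorsII, (2.46) p.231] -/
theorem geomT_dist_ends_le (hRM : 2 ≤ R * Mh) (hMh : 1 ≤ Mh) (hP : ∀ μ, 1 ≤ P' μ) (i : BondIdx (domT hN D hk))
    {x : Site (PV d ℓ m K hd hL) 0} (hx : iterBlockOf (lvl hN D hk i) x = i.1.2.src ∨ iterBlockOf (lvl hN D hk i) x = i.1.2.tgt) :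
    (geomT D).dist (β hN D hk i) (blkOf D.toDomains (toBox hN x)) ≤ (ℓ : ℝ) + 3 := by
  have h := distT_ends_le hN D hk hRM hMh hP i hx
  change (((bondT D).dist (β hN D hk i) (blkOf D.toDomains (toBox hN x)) : ℕ) : ℝ) ≤ (ℓ : ℝ) + 3
  exact_mod_cast h

end Geometry

/-! ## §4  (2.142) for the genuine k-level `QGQ*` -/

section Ineq2142

variable (hN : ∀ μ, N0 ℓ Mh k P' μ = (PV d ℓ m K hd hL).sitesPerDir 0) (D : TDomains d ℓ Mh k P' R) (hk : k ≤ m + K)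

/-- **THE BLOCKS OF `𝔅` MET BY THE DOUBLE BLOCK** `B^j(y) ∪ B^j(y + e_μ)` of an index bond. [cite: Balaban1984PropagatorsII, (2.45) p.231, (2.142) p.248] -/
def metBlocks (i : BondIdx (domT hN D hk)) : Finset ↥(bset D.toDomains) :=
  (iterBlock (lvl hN D hk i) i.1.2.src ∪ iterBlock (lvl hN D hk i) i.1.2.tgt).image fun z => blkOf D.toDomains (toBox hN z)

/-- a fine site of the double block has its block in `metBlocks`. [cite: Balaban1984PropagatorsII, (2.45) p.231, bookkeeping] -/
theorem mem_metBlocks (i : BondIdx (domT hN D hk)) {z : Site (PV d ℓ m K hd hL) 0}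
    (hz : iterBlockOf (lvl hN D hk i) z = i.1.2.src ∨ iterBlockOf (lvl hN D hk i) z = i.1.2.tgt) :
    blkOf D.toDomains (toBox hN z) ∈ metBlocks hN D hk i := by
  unfold metBlocks
  refine Finset.mem_image_of_mem _ ?_
  rw [Finset.mem_union, mem_iterBlock, mem_iterBlock]
  exact hz

/-- every met block is the block of a site of the double block. [cite: Balaban1984PropagatorsII, (2.45) p.231, bookkeeping] -/
theorem exists_of_mem_metBlocks (i : BondIdx (domT hN D hk)) {y' : ↥(bset D.toDomains)} (h : y' ∈ metBlocks hN D hk i) :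
    ∃ z : Site (PV d ℓ m K hd hL) 0, (iterBlockOf (lvl hN D hk i) z = i.1.2.src ∨ iterBlockOf (lvl hN D hk i) z = i.1.2.tgt) ∧
      blkOf D.toDomains (toBox hN z) = y' := by
  unfold metBlocks at h
  rw [Finset.mem_image] at h
  obtain ⟨z, hz, rfl⟩ := h
  rw [Finset.mem_union, mem_iterBlock, mem_iterBlock] at hz
  exact ⟨z, hz, rfl⟩

/-- **ONE END BLOCK MEETS AT MOST `L^D` BLOCKS OF `𝔅`** (its sites have level `≥ max(j−1, 1)`, and the block of `𝔅` of a site is read on its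
`max(j−1,1)`-block, of which `B^j(y)` contains `≤ L^D`). [cite: Balaban1984PropagatorsII, (2.1)–(2.2) p.224, (2.45) p.231] -/
theorem card_image_blkOf_le (hRM : 2 ≤ R * Mh) (i : BondIdx (domT hN D hk)) {y : Site (PV d ℓ m K hd hL) (lvl hN D hk i)}
    (hy : y = i.1.2.src ∨ y = i.1.2.tgt) :
    ((iterBlock (lvl hN D hk i) y).image fun z => blkOf D.toDomains (toBox hN z)).card ≤ ((ℓ + 1) ^ (d + 1)) := by
  classical
  have hjm : lvl hN D hk i ≤ m + K := lvl_le_mK hN D hk i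
  -- LEVEL-0 TWIN (J7): for `j ≤ 1` the whole block `B^j(y)` has `≤ L^D` sites
  rcases Nat.lt_or_ge (lvl hN D hk i) 2 with hj2 | hj2
  · refine Finset.card_image_le.trans ?_
    rw [B5Eq118OneStroke.card_iterBlock _ hjm]
    have h1 : ((ℓ + 1) ^ (d + 1)) ^ (lvl hN D hk i) ≤ ((ℓ + 1) ^ (d + 1)) ^ 1 := Nat.pow_le_pow_right (by positivity) (by omega)
    rwa [pow_one] at h1
  have hj1 : 1 ≤ lvl hN D hk i := le_trans one_le_two hj2
  set n := max (lvl hN D hk i - 1) 1 with hndef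
  have hn1 : 1 ≤ n := le_max_right _ _
  have hnj : n ≤ lvl hN D hk i := max_le (Nat.sub_le _ 1) hj1
  have hnm : n ≤ m + K := hnj.trans hjm
  set S := iterBlock (lvl hN D hk i) y with hSdef
  set F : Site (PV d ℓ m K hd hL) 0 → ↥(bset D.toDomains) := fun z => blkOf D.toDomains (toBox hN z) with hFdef
  have hends : ∀ {z : Site (PV d ℓ m K hd hL) 0}, z ∈ S → (iterBlockOf (lvl hN D hk i) z = i.1.2.src ∨ iterBlockOf (lvl hN D hk i) z = i.1.2.tgt) := by
    intro z hz
    rw [hSdef, mem_iterBlock] at hz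
    rcases hy with hy | hy
    · left; rw [← hy]; exact hz
    · right; rw [← hy]; exact hz
  have hlevn : ∀ {z : Site (PV d ℓ m K hd hL) 0}, z ∈ S → n ≤ D.lev (toBox hN z : Fin (d + 1) → ℤ) := fun hz =>
    max_le (pred_le_lev_of_ends hN D hk hRM i (hends hz)) (by have := pred_le_lev_of_ends hN D hk hRM i (hends hz); omega)
  -- every fibre of `F` on `S` contains a whole `n`-block
  have hfib : ∀ b ∈ S.image F, ((ℓ + 1) ^ (d + 1)) ^ n ≤ (S.filter fun z => F z = b).card := by
    intro b hb
    rw [Finset.mem_image] at hb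
    obtain ⟨z₀, hz₀, rfl⟩ := hb
    have hsub : iterBlock n (iterBlockOf n z₀) ⊆ S.filter fun z => F z = F z₀ := by
      intro z' hz'
      rw [mem_iterBlock] at hz'
      have hzS : z' ∈ S := by
        rw [hSdef, mem_iterBlock] at hz₀ ⊢
        rw [← hz₀]
        exact iterBlockOf_eq_of_le hnj hz'
      rw [Finset.mem_filter]
      exact ⟨hzS, blkOf_eq_of_sameBlock hN D hk (hlevn hzS) (hlevn hz₀) hz'⟩
    have := Finset.card_le_card hsub
    rwa [B5Eq118OneStroke.card_iterBlock _ hnm] at this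
  have hsum := Finset.card_eq_sum_card_image F S
  have hS : S.card = ((ℓ + 1) ^ (d + 1)) ^ (lvl hN D hk i) := B5Eq118OneStroke.card_iterBlock _ hjm _
  have hge : (S.image F).card * ((ℓ + 1) ^ (d + 1)) ^ n ≤ ((ℓ + 1) ^ (d + 1)) ^ (lvl hN D hk i) := by
    have h := Finset.sum_le_sum hfib
    rw [Finset.sum_const, smul_eq_mul, ← hsum, hS] at h
    exact h
  have hpow : ((ℓ + 1) ^ (d + 1)) ^ (lvl hN D hk i) ≤ (ℓ + 1) ^ (d + 1) * ((ℓ + 1) ^ (d + 1)) ^ n := by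
    rw [← pow_succ']
    exact Nat.pow_le_pow_right (by positivity) (by omega)
  have hpos : 0 < ((ℓ + 1) ^ (d + 1)) ^ n := by positivity
  exact Nat.le_of_mul_le_mul_right (hge.trans hpow) hpos

/-- **THE DOUBLE BLOCK MEETS AT MOST `2L^D` BLOCKS OF `𝔅`.** [cite: Balaban1984PropagatorsII, (2.45) p.231] -/
theorem card_metBlocks_le (hRM : 2 ≤ R * Mh) (i : BondIdx (domT hN D hk)) :
    (metBlocks hN D hk i).card ≤ 2 * (ℓ + 1) ^ (d + 1) := by
  classical
  unfold metBlocks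
  rw [Finset.image_union]
  refine (Finset.card_union_le _ _).trans ?_
  have h1 := card_image_blkOf_le hN D hk hRM i (y := i.1.2.src) (Or.inl rfl)
  have h2 := card_image_blkOf_le hN D hk hRM i (y := i.1.2.tgt) (Or.inr rfl)
  omega

/-- **`G q_{i′}` IS SMALL AND DECAYS AWAY FROM `β i′`**: for `T = onFun G` with the (2.136)₁ majorant `A·pref·e^{−δd_T}`,
`|(T q_{i′})(f)| ≤ 2L^D·A·e^{δ(ℓ+3)}·L^{−j′D}·pref(y(f))·e^{−δ d_T(y(f), β i′)}` (`ℓ + 3 = L + 2`). [cite: Balaban1984PropagatorsII, (2.136) p.247, (2.142) p.248] -/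
theorem abs_apply_qwt_le (hRM : 2 ≤ R * Mh) (hMh : 1 ≤ Mh) (hP : ∀ μ, 1 ≤ P' μ)
    {T : Module.End ℝ (PBond (PV d ℓ m K hd hL) 0 → ℝ)} {A δ cf : ℝ} (hA : 0 ≤ A) (hδ : 0 ≤ δ)
    (hT : HasMajorant (g := geomT D) (blkV1 hN D) T (fun y y' => A * pref cf y * Real.exp (-(δ * (geomT D).dist y y'))))
    (i' : BondIdx (domT hN D hk)) (f : PBond (PV d ℓ m K hd hL) 0) :
    |T (qwt hN D hk i') f| ≤ 2 * (((ℓ + 1 : ℕ) : ℝ)) ^ (d + 1) * A * Real.exp (δ * ((ℓ : ℝ) + 3)) *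
      ((((ℓ + 1 : ℕ) : ℝ) ^ (d + 1)) ^ (lvl hN D hk i'))⁻¹ * pref cf (blkV1 hN D f) *
        Real.exp (-(δ * (geomT D).dist (blkV1 hN D f) (β hN D hk i'))) := by
  classical
  set j' := lvl hN D hk i'
  have hjm := lvl_le_mK hN D hk i'
  -- support and size of `q_{i′}`
  have hB : (0 : ℝ) ≤ ((((ℓ + 1 : ℕ) : ℝ) ^ (d + 1)) ^ j')⁻¹ := by positivity
  have hμB : ∀ f', |qwt hN D hk i' f'| ≤ ((((ℓ + 1 : ℕ) : ℝ) ^ (d + 1)) ^ j')⁻¹ := fun f' => by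
    rw [abs_of_nonneg (qwt_nonneg hN D hk i' f')]; exact qwt_le hN D hk i' f'
  have hμN : ∀ f', qwt hN D hk i' f' ≠ 0 → blkV1 hN D f' ∈ metBlocks hN D hk i' := by
    intro f' hf'
    obtain ⟨x', hx', t', ht', rfl⟩ := exists_of_qwt_ne_zero hN D hk i' hf'
    rw [mem_iterBlock] at hx'
    refine mem_metBlocks hN D hk i' ?_
    change iterBlockOf j' (runSite x' i'.1.2.dir t') = _ ∨ iterBlockOf j' (runSite x' i'.1.2.dir t') = _
    rcases iterBlockOf_runSite_mem hjm x' i'.1.2.dir ht'.le with h | h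
    · exact Or.inl (h.trans hx')
    · right; rw [h, hx']; rfl
  have h0 := abs_apply_le_of_support (g := geomT D) (blkV1 hN D) hT (metBlocks hN D hk i') hB hμB hμN f
  refine h0.trans ?_
  -- each met block is within `ℓ + 3 = L + 2` of `β i′`
  have hprefpos : 0 ≤ pref cf (blkV1 hN D f) := sq_nonneg _
  have hterm : ∀ y' ∈ metBlocks hN D hk i',
      A * pref cf (blkV1 hN D f) * Real.exp (-(δ * (geomT D).dist (blkV1 hN D f) y')) ≤
        A * pref cf (blkV1 hN D f) * (Real.exp (δ * ((ℓ : ℝ) + 3)) * Real.exp (-(δ * (geomT D).dist (blkV1 hN D f) (β hN D hk i')))) := by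
    intro y' hy'
    obtain ⟨z, hz, rfl⟩ := exists_of_mem_metBlocks hN D hk i' hy'
    refine mul_le_mul_of_nonneg_left ?_ (mul_nonneg hA hprefpos)
    rw [← Real.exp_add]
    apply Real.exp_le_exp.2
    have hdz := geomT_dist_ends_le hN D hk hRM hMh hP i' hz
    have htri : (geomT D).dist (blkV1 hN D f) (β hN D hk i') ≤
        (geomT D).dist (blkV1 hN D f) (blkOf D.toDomains (toBox hN z)) + (geomT D).dist (blkOf D.toDomains (toBox hN z)) (β hN D hk i') := by
      have hc := B6Geom246MultiLevelTorusL0.connectedT (D := D) hMh hP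
      change (((bondT D).dist _ _ : ℕ) : ℝ) ≤ (((bondT D).dist _ _ : ℕ) : ℝ) + (((bondT D).dist _ _ : ℕ) : ℝ)
      exact_mod_cast hc.dist_triangle
    have hsymm : (geomT D).dist (blkOf D.toDomains (toBox hN z)) (β hN D hk i') = (geomT D).dist (β hN D hk i') (blkOf D.toDomains (toBox hN z)) := by
      change (((bondT D).dist _ _ : ℕ) : ℝ) = (((bondT D).dist _ _ : ℕ) : ℝ)
      rw [SimpleGraph.dist_comm]
    rw [hsymm] at htri
    nlinarith
  have hcard : ((metBlocks hN D hk i').card : ℝ) ≤ 2 * (((ℓ + 1 : ℕ) : ℝ)) ^ (d + 1) := by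
    exact_mod_cast card_metBlocks_le hN D hk hRM i'
  calc ((((ℓ + 1 : ℕ) : ℝ) ^ (d + 1)) ^ j')⁻¹ * ∑ y' ∈ metBlocks hN D hk i', A * pref cf (blkV1 hN D f) * Real.exp (-(δ * (geomT D).dist (blkV1 hN D f) y'))
      ≤ ((((ℓ + 1 : ℕ) : ℝ) ^ (d + 1)) ^ j')⁻¹ * ∑ y' ∈ metBlocks hN D hk i',
          A * pref cf (blkV1 hN D f) * (Real.exp (δ * ((ℓ : ℝ) + 3)) * Real.exp (-(δ * (geomT D).dist (blkV1 hN D f) (β hN D hk i')))) :=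
        mul_le_mul_of_nonneg_left (Finset.sum_le_sum hterm) hB
    _ = ((((ℓ + 1 : ℕ) : ℝ) ^ (d + 1)) ^ j')⁻¹ * ((metBlocks hN D hk i').card *
          (A * pref cf (blkV1 hN D f) * (Real.exp (δ * ((ℓ : ℝ) + 3)) * Real.exp (-(δ * (geomT D).dist (blkV1 hN D f) (β hN D hk i')))))) := by
        rw [Finset.sum_const, nsmul_eq_mul]
    _ ≤ ((((ℓ + 1 : ℕ) : ℝ) ^ (d + 1)) ^ j')⁻¹ * ((2 * (((ℓ + 1 : ℕ) : ℝ)) ^ (d + 1)) *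
          (A * pref cf (blkV1 hN D f) * (Real.exp (δ * ((ℓ : ℝ) + 3)) * Real.exp (-(δ * (geomT D).dist (blkV1 hN D f) (β hN D hk i')))))) := by
        refine mul_le_mul_of_nonneg_left (mul_le_mul_of_nonneg_right hcard ?_) hB
        positivity
    _ = _ := by ring

/-- `pref` is monotone in the level: `pref(y(f)) ≤ (L^j/c_f)²` when the block of `f` has level `≤ j`. [cite: Balaban1984PropagatorsII, (2.136) p.247 («(L^jη)²»), bookkeeping] -/
theorem pref_le_of_level_le {cf : ℝ} {y : ↥(B6Geom246MultiLevelBoxL0.bset D.toDomains)} {j : ℕ} (h : y.1.1 ≤ j) :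
    pref cf (D := D) y ≤ ((((ℓ + 1 : ℕ) : ℝ)) ^ j / cf) ^ 2 := by
  unfold pref
  rw [div_pow, div_pow]
  by_cases hcf : cf = 0
  · simp [hcf]
  · refine div_le_div_of_nonneg_right ?_ (sq_nonneg cf)
    rw [← pow_mul, ← pow_mul]
    exact pow_le_pow_right₀ (by exact_mod_cast Nat.succ_le_succ (Nat.zero_le ℓ)) (by omega)

/-- **(2.142) FROM A (2.136)₁ MAJORANT** (the printed sentence «From (2.136) we have (2.142)» for the genuine k-level `QGQ*`, with (2.136)₁ as
the hypothesis `hT`): `|X(i, i′)| ≤ 2L^D·A·e^{2δ(ℓ+3)}·(L^{j(i)}/c_f)²·(L^{j(i′)D})⁻¹·e^{−δ d_T(β i, β i′)}`.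
[cite: Balaban1984PropagatorsII, (2.142) p.248] -/
theorem ineq2142_of_majorant (hRM : 2 ≤ R * Mh) (hMh : 1 ≤ Mh) (hP : ∀ μ, 1 ≤ P' μ)
    {cf : ℝ} (hcf : cf ≠ 0) {w : BondIdx (domT hN D hk) → ℝ} (hw : ∀ i, 0 < w i) {A δ : ℝ} (hA : 0 ≤ A) (hδ : 0 ≤ δ)
    (hT : HasMajorant (g := geomT D) (blkV1 hN D) (onFun (GE (domT hN D hk) hcf hw))
      (fun y y' => A * pref cf y * Real.exp (-(δ * (geomT D).dist y y'))))
    (i i' : BondIdx (domT hN D hk)) :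
    |X hN D hk hcf hw i i'| ≤ 2 * (((ℓ + 1 : ℕ) : ℝ)) ^ (d + 1) * A * Real.exp (2 * (δ * ((ℓ : ℝ) + 3))) *
      ((((ℓ + 1 : ℕ) : ℝ)) ^ (lvl hN D hk i) / cf) ^ 2 * ((((ℓ + 1 : ℕ) : ℝ) ^ (d + 1)) ^ (lvl hN D hk i'))⁻¹ *
        Real.exp (-(δ * (geomT D).dist (β hN D hk i) (β hN D hk i'))) := by
  rw [X_eq_sum]
  set j := lvl hN D hk i
  -- the uniform bound on the contour bonds of `i`
  set S : ℝ := 2 * (((ℓ + 1 : ℕ) : ℝ)) ^ (d + 1) * A * Real.exp (2 * (δ * ((ℓ : ℝ) + 3))) *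
      ((((ℓ + 1 : ℕ) : ℝ)) ^ j / cf) ^ 2 * ((((ℓ + 1 : ℕ) : ℝ) ^ (d + 1)) ^ (lvl hN D hk i'))⁻¹ *
        Real.exp (-(δ * (geomT D).dist (β hN D hk i) (β hN D hk i'))) with hSdef
  have hbond : ∀ x ∈ iterBlock j i.1.2.src, ∀ t < (ℓ + 1) ^ j,
      |onFun (GE (domT hN D hk) hcf hw) (qwt hN D hk i') (runBond x i.1.2.dir t)| ≤ S := by
    intro x hx t ht
    rw [mem_iterBlock] at hx
    set f := runBond x i.1.2.dir t
    have hf : iterBlockOf j f.src = i.1.2.src ∨ iterBlockOf j f.src = i.1.2.tgt := by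
      change iterBlockOf j (runSite x i.1.2.dir t) = _ ∨ iterBlockOf j (runSite x i.1.2.dir t) = _
      rcases iterBlockOf_runSite_mem (lvl_le_mK hN D hk i) x i.1.2.dir ht.le with h | h
      · exact Or.inl (h.trans hx)
      · right; rw [h, hx]; rfl
    refine (abs_apply_qwt_le hN D hk hRM hMh hP hA hδ hT i' f).trans ?_
    -- `pref(y(f)) ≤ (L^j/c_f)²`
    have hpref : pref cf (blkV1 hN D f) ≤ ((((ℓ + 1 : ℕ) : ℝ)) ^ j / cf) ^ 2 := by
      refine pref_le_of_level_le D ?_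
      change D.toDomains.lev (toBox hN f.src : Fin (d + 1) → ℤ) ≤ j
      rw [B6MultiLevelTorusOperatorL0.TDomains.toDomains_lev]
      exact lev_le_of_ends hN D hk i hf
    -- `d(y(f), β i′) ≥ d(β i, β i′) − (ℓ + 3)`
    have hdist : Real.exp (-(δ * (geomT D).dist (blkV1 hN D f) (β hN D hk i'))) ≤
        Real.exp (δ * ((ℓ : ℝ) + 3)) * Real.exp (-(δ * (geomT D).dist (β hN D hk i) (β hN D hk i'))) := by
      rw [← Real.exp_add]
      apply Real.exp_le_exp.2
      have hdz := geomT_dist_ends_le hN D hk hRM hMh hP i hf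
      have htri : (geomT D).dist (β hN D hk i) (β hN D hk i') ≤
          (geomT D).dist (β hN D hk i) (blkV1 hN D f) + (geomT D).dist (blkV1 hN D f) (β hN D hk i') := by
        have hc := B6Geom246MultiLevelTorusL0.connectedT (D := D) hMh hP
        change (((bondT D).dist _ _ : ℕ) : ℝ) ≤ (((bondT D).dist _ _ : ℕ) : ℝ) + (((bondT D).dist _ _ : ℕ) : ℝ)
        exact_mod_cast hc.dist_triangle
      change (geomT D).dist (β hN D hk i) (blkOf D.toDomains (toBox hN f.src)) ≤ (ℓ : ℝ) + 3 at hdz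
      change (geomT D).dist (β hN D hk i) (β hN D hk i') ≤ (geomT D).dist (β hN D hk i) (blkOf D.toDomains (toBox hN f.src)) + _ at htri
      nlinarith
    have h1 : 0 ≤ 2 * (((ℓ + 1 : ℕ) : ℝ)) ^ (d + 1) * A * Real.exp (δ * ((ℓ : ℝ) + 3)) * ((((ℓ + 1 : ℕ) : ℝ) ^ (d + 1)) ^ (lvl hN D hk i'))⁻¹ := by
      positivity
    calc 2 * (((ℓ + 1 : ℕ) : ℝ)) ^ (d + 1) * A * Real.exp (δ * ((ℓ : ℝ) + 3)) * ((((ℓ + 1 : ℕ) : ℝ) ^ (d + 1)) ^ (lvl hN D hk i'))⁻¹ *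
          pref cf (blkV1 hN D f) * Real.exp (-(δ * (geomT D).dist (blkV1 hN D f) (β hN D hk i')))
        ≤ 2 * (((ℓ + 1 : ℕ) : ℝ)) ^ (d + 1) * A * Real.exp (δ * ((ℓ : ℝ) + 3)) * ((((ℓ + 1 : ℕ) : ℝ) ^ (d + 1)) ^ (lvl hN D hk i'))⁻¹ *
          ((((ℓ + 1 : ℕ) : ℝ)) ^ j / cf) ^ 2 * (Real.exp (δ * ((ℓ : ℝ) + 3)) * Real.exp (-(δ * (geomT D).dist (β hN D hk i) (β hN D hk i')))) := by
          refine mul_le_mul (mul_le_mul_of_nonneg_left hpref h1) hdist (Real.exp_pos _).le ?_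
          exact mul_nonneg h1 (sq_nonneg _)
      _ = S := by rw [hSdef, show (2 : ℝ) * (δ * ((ℓ : ℝ) + 3)) = δ * ((ℓ : ℝ) + 3) + δ * ((ℓ : ℝ) + 3) by ring, Real.exp_add]; ring
  have h := abs_QE_apply_le hN D hk i (WithLp.toLp 2 (onFun (GE (domT hN D hk) hcf hw) (qwt hN D hk i'))) (S := S)
    (fun x hx t ht => by rw [WithLp.ofLp_toLp]; exact hbond x hx t ht)
  rw [QE_apply_eq_sum] at h
  simpa only [WithLp.ofLp_toLp] using h

/-- **(2.142) FOR THE GENUINE k-LEVEL `QGQ*`** (print p. 248: «From (2.136) we have |(QGQ*)(b, b′)| ≤ O(1)(L^jη)²(L^{j′}η)^{−d}e^{−δ₃d(b,b′)}»):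
with the constant `A` and rate `δ₃ = delta3 α (2σ)` of r03 g22's k-level (2.136)₁ `prop26_2136_kLevel_unconditional` (V1 torus, `k ≥ 2`, `M_h = L^a ≥ 8`,
`M₂ ≤ L·M_h`, `R ≥ 2L²`, `P′ ≥ 5`, `L ≥ 5`, `Placed`, weights in the band (2.16)), for ALL index bonds `i, i′`:
`|⟪e_i, QGQ*e_{i′}⟫| ≤ A′·(L^{j(i)}/c_f)²·(L^{j(i′)D})⁻¹·e^{−δ₃ d_T(β i, β i′)}`, `A′ = 2L^D·A·e^{2δ₃(ℓ+3)}` (`ℓ + 3 = L + 2`).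
[cite: Balaban1984PropagatorsII, (2.142) p.248] -/
theorem ineq2142_kLevel (d ℓ : ℕ) (hd : 1 ≤ d + 1) (hL : Odd (ℓ + 1) ∧ 1 < ℓ + 1) {b₀ b₁ : ℝ} (hb₀ : 0 < b₀) (hb₁ : b₀ ≤ b₁) :
    ∃ σ₁ : ℝ, 0 < σ₁ ∧ ∀ (σ : ℝ), 0 < σ → σ ≤ σ₁ → ∀ (α : ℝ), 0 < α → α ≤ 1 →
    ∃ A' M₂ : ℝ, 0 ≤ A' ∧ 0 < M₂ ∧
    ∀ (m K : ℕ) {Mh k R : ℕ} {P' : Fin (d + 1) → ℕ}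
      (hN : ∀ μ, N0 ℓ Mh k P' μ = (PV d ℓ m K hd hL).sitesPerDir 0) (D : TDomains d ℓ Mh k P' R) (hk : k ≤ m + K) (_ : 2 ≤ k)
      {a : ℕ} (_ : Mh = (ℓ + 1) ^ a) (_ : 8 ≤ Mh) (_ : 2 * (ℓ + 1) ^ 2 ≤ R) (_ : ∀ μ, 5 ≤ P' μ) (_ : 4 ≤ ℓ)
      (_ : ∀ c : ↥(cubes D.toDomains), Placed ℓ k P' c.1) (_ : M₂ ≤ ((ℓ : ℝ) + 1) * Mh)
      {cf : ℝ} (hcf : cf ≠ 0) {w : BondIdx (domT hN D hk) → ℝ} (hw : ∀ i, 0 < w i) (_ : GlobalBand b₀ b₁ cf w),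
      ∀ i i' : BondIdx (domT hN D hk),
        |X hN D hk hcf hw i i'| ≤ A' * ((((ℓ + 1 : ℕ) : ℝ)) ^ (lvl hN D hk i) / cf) ^ 2 * ((((ℓ + 1 : ℕ) : ℝ) ^ (d + 1)) ^ (lvl hN D hk i'))⁻¹ *
          Real.exp (-(delta3 α (2 * σ) * (geomT D).dist (β hN D hk i) (β hN D hk i'))) := by
  obtain ⟨σ₁, hσ₁, h⟩ := prop26_2136_kLevel_unconditional d ℓ hd hL hb₀ hb₁
  refine ⟨σ₁, hσ₁, fun σ hσ hσ1 α hα hα1 => ?_⟩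
  obtain ⟨A, M₂, hA, hM₂, hmaj⟩ := h σ hσ hσ1 α hα hα1
  have hδ : 0 ≤ delta3 α (2 * σ) := delta3_two_mul_nonneg hα1 hσ
  refine ⟨2 * (((ℓ + 1 : ℕ) : ℝ)) ^ (d + 1) * A * Real.exp (2 * (delta3 α (2 * σ) * ((ℓ : ℝ) + 3))), M₂, by positivity, hM₂, ?_⟩
  intro m K Mh k R P' hN D hk hk2 a hMha hM8 hR2 hP5 hℓ hpl hM cf hcf w hw hwb i i'
  have hT := hmaj m K hN D hk hk2 hMha hM8 hR2 hP5 hℓ hpl hM hcf hw hwb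
  have hMh : 1 ≤ Mh := le_trans (by norm_num) hM8
  have hP : ∀ μ, 1 ≤ P' μ := fun μ => le_trans (by norm_num) (hP5 μ)
  have hRM : 2 ≤ R * Mh := by
    have hR1 : 1 ≤ R := by
      have h1 : 1 ≤ (ℓ + 1) ^ 2 := Nat.one_le_pow _ _ (by omega)
      omega
    calc 2 ≤ 1 * 8 := by norm_num
      _ ≤ R * Mh := Nat.mul_le_mul hR1 hM8
  exact ineq2142_of_majorant hN D hk hRM hMh hP hcf hw hA hδ hT i i'

/-- the symmetric reading (`X` is symmetric): the same bound with the roles of `i`, `i′` exchanged in the length factors.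
[cite: Balaban1984PropagatorsII, (2.142) p.248, p.238 («The choice of factors is again arbitrary»)] -/
theorem abs_X_le_symm {hN : ∀ μ, N0 ℓ Mh k P' μ = (PV d ℓ m K hd hL).sitesPerDir 0} {D : TDomains d ℓ Mh k P' R} {hk : k ≤ m + K}
    {cf : ℝ} {hcf : cf ≠ 0} {w : BondIdx (domT hN D hk) → ℝ} {hw : ∀ i, 0 < w i} {A' δ : ℝ}
    (h : ∀ i i' : BondIdx (domT hN D hk),
      |X hN D hk hcf hw i i'| ≤ A' * ((((ℓ + 1 : ℕ) : ℝ)) ^ (lvl hN D hk i) / cf) ^ 2 * ((((ℓ + 1 : ℕ) : ℝ) ^ (d + 1)) ^ (lvl hN D hk i'))⁻¹ *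
        Real.exp (-(δ * (geomT D).dist (β hN D hk i) (β hN D hk i'))))
    (i i' : BondIdx (domT hN D hk)) :
    |X hN D hk hcf hw i i'| ≤ A' * ((((ℓ + 1 : ℕ) : ℝ)) ^ (lvl hN D hk i') / cf) ^ 2 * ((((ℓ + 1 : ℕ) : ℝ) ^ (d + 1)) ^ (lvl hN D hk i))⁻¹ *
        Real.exp (-(δ * (geomT D).dist (β hN D hk i) (β hN D hk i'))) := by
  rw [X_symm]
  have hs : (geomT D).dist (β hN D hk i) (β hN D hk i') = (geomT D).dist (β hN D hk i') (β hN D hk i) := by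
    change (((bondT D).dist _ _ : ℕ) : ℝ) = (((bondT D).dist _ _ : ℕ) : ℝ)
    rw [SimpleGraph.dist_comm]
  rw [hs]
  exact h i' i

end Ineq2142

end Literature.MathematicalPhysics.QuantumFieldTheory.Balaban1983to89.B6Ineq2142KLevelV1L0
end

-- L0-port marker: J7 call sites rewritten
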